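import Literature.MathematicalPhysics.QuantumLattice.HubbardNNNHoppingParticleHole
import Literature.MathematicalPhysics.QuantumLattice.HubbardRectangularTorus
import HarnessLib

/-!
# The `t–t'` Hubbard model on rectangular tori: lattice symmetries and particle–hole symmetry

Topic `Literature/MathematicalPhysics/QuantumLattice`; a companion of `HubbardNNNHopping.lean`
(`hubbardRectTorusTT' a b t t' U = hamiltonian (fermionRectTorusGraph a b) t U +
hamiltonian (fermionRectTorusDiagGraph a b) t' 0` on `ℤ/aℤ × ℤ/bℤ`, `hubbardTorusTT' L t t' U` on
`(ℤ/Lℤ)²`), of `HubbardRectangularTorus.lean` (site relabellings `relabel (Orb.mapEquiv f)`,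
`groundEnergy_relabel`, `squareToRect`) and of `HubbardNNNHoppingParticleHole.lean`
(`P H(t,t',U) Pᴴ = H(t,-t',U) - U N + U|Λ|` on the square torus).

## Content

* `groundEnergy_hamiltonian_add_eq_of_iso` (generic: a site bijection carrying both hopping graphs
  preserves all sector energies) and `groundEnergy_hubbardTorusTT'_eq_rect` — the square torus
  `(ℤ/Lℤ)²` (sites `Fin 2 → Fin L`, adjacency through `ZMod L`) IS the rectangular torus `L × L`
  (sites `Fin L ×ₗ Fin L`, adjacency through representatives) for the `t–t'` model as well:
  `E_{(ℤ/Lℤ)²}(N) = E_{L×L}(N)`.  (The two presentations are the ones different certificate producers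
  use; this is the theorem that lets an upper bound stated on one and a lower bound stated on the
  other form one bracket.  The coordinate swap `E_{a×b}(N) = E_{b×a}(N)` of the `t–t'` model is
  `groundEnergy_hubbardRectTorusTT'_swap` in `HubbardNNNHoppingCut.lean`.)
* `rectStagger a b (x, y) = (-1)^{x+y}` and, for `a, b` even, `rectStagger_eq_neg_of_adj`
  (nearest neighbours: opposite signs) / `rectStagger_eq_of_diagAdj` (diagonal neighbours: equal
  signs); hence `particleHole_hubbardRectTorusTT'`:
  `P H_{a×b}(t,t',U) Pᴴ = H_{a×b}(t,-t',U) - U N + U ab`, and the sector identities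
  `groundEnergy_hubbardRectTorusTT'_particleHole` (`E_{t,t',U}(2ab - N) = E_{t,-t',U}(N) - U N + U ab`),
  its primed form, and the `t' = 0` case `groundEnergyAt_fermionRectTorus_particleHole`.

## Sources

F. H. L. Essler, H. Frahm, F. Göhmann, A. Klümper, V. E. Korepin, *The One-Dimensional Hubbard
Model* (CUP 2005): §2.2.1 eqs. (2.32)–(2.39) (site permutations are implemented by unitary
operators on Fock space — the transposition operators of Heilmann–Lieb — so a lattice symmetry of the
hopping graph is a symmetry of `H`), §2.2.2 (spatial symmetries), §2.2.4 eqs. (2.59)–(2.61) (the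
particle–hole / Shiba transformation with the bipartite sign; a bond inside one sublattice picks up a
minus sign; `N ↦ 2L - N`); E. H. Lieb, F. Y. Wu, Physica A 321 (2003) 1, §1 eq. (3)
(`E(M,M') = -(N_a - N)U + E(N_a - M, N_a - M')`); E. H. Lieb, PRL 62 (1989) 1201, Theorem 2
(bipartite lattices, the sign `ε_x = ±1`); H. Q. Lin, J. E. Hirsch, PRB 35 (1987) 3359 (the `t–t'`
model, `t' ↦ -t'` under particle–hole); J. P. F. LeBlanc et al., PRX 5 (2015) 041041, eq. (1).
Everything here is elementary finite-dimensional algebra over the tree's Jordan–Wigner matrices;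
cite tags name the published statements being formalised, private helpers are [folklore].
-/

noncomputable section

open Matrix Finset
open scoped ComplexOrder BigOperators

namespace Literature.MathematicalPhysics.QuantumLattice

open HubbardWave0 Literature.Probability.LatticeModels

/-! ### Two hopping graphs on one site set: relabelling -/

section TwoGraphs

variable {Λ Λ' : Type*} [LinearOrder Λ] [LinearOrder Λ'] [Fintype Λ] [Fintype Λ']
  (G₁ G₂ : SimpleGraph Λ) [DecidableRel G₁.Adj] [DecidableRel G₂.Adj]
  (G₁' G₂' : SimpleGraph Λ') [DecidableRel G₁'.Adj] [DecidableRel G₂'.Adj]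

/-- Covariance of a two-graph Hamiltonian `H_{G₁}(t,U) + H_{G₂}(t',U')` under a site bijection
carrying both adjacencies. [folklore] -/
private theorem relabel_hamiltonian_add (f : Λ ≃ Λ') (h₁ : ∀ x y, G₁'.Adj (f x) (f y) ↔ G₁.Adj x y)
    (h₂ : ∀ x y, G₂'.Adj (f x) (f y) ↔ G₂.Adj x y) (t U t' U' : ℝ) :
    relabel (Orb.mapEquiv f) (hamiltonian G₁ t U + hamiltonian G₂ t' U') =
      hamiltonian G₁' t U + hamiltonian G₂' t' U' := by
  rw [map_add, relabel_hamiltonian G₁ G₁' f h₁, relabel_hamiltonian G₂ G₂' f h₂]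

/-- **Sector energies of a two-graph (e.g. `t–t'`) Hubbard Hamiltonian are invariant under site
bijections carrying both hopping graphs** (site permutations / relabellings act by unitary signed
permutations of Fock space, Essler et al. (2005) §2.2.1 eqs. (2.32)–(2.39), and preserve every
particle-number sector). [cite: EsslerEtAl2005, §2.2.1 eqs. (2.32)–(2.39)] -/
theorem groundEnergy_hamiltonian_add_eq_of_iso (f : Λ ≃ Λ')
    (h₁ : ∀ x y, G₁'.Adj (f x) (f y) ↔ G₁.Adj x y) (h₂ : ∀ x y, G₂'.Adj (f x) (f y) ↔ G₂.Adj x y)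
    (t U t' U' : ℝ) (N : ℕ) :
    groundEnergy (hamiltonian G₁' t U + hamiltonian G₂' t' U') N =
      groundEnergy (hamiltonian G₁ t U + hamiltonian G₂ t' U') N := by
  rw [← relabel_hamiltonian_add G₁ G₂ G₁' G₂' f h₁ h₂, groundEnergy_relabel]

end TwoGraphs

/-! ### The square torus `(ℤ/Lℤ)²` is the rectangular torus `L × L`, diagonal bonds included -/

/-- `ringAdj` of representatives `u, v < L`, read in `ZMod L`. [folklore] -/
private theorem ringAdj_iff_zmod {L : ℕ} (u v : Fin L) :
    ringAdj L u v ↔ ((u : ℕ) : ZMod L) ≠ ((v : ℕ) : ZMod L) ∧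
      (((v : ℕ) : ZMod L) = ((u : ℕ) : ZMod L) + 1 ∨
        ((u : ℕ) : ZMod L) = ((v : ℕ) : ZMod L) + 1) := by
  have hinj : ((u : ℕ) : ZMod L) = ((v : ℕ) : ZMod L) ↔ u = v := by
    rw [ZMod.natCast_eq_natCast_iff', Nat.mod_eq_of_lt u.isLt, Nat.mod_eq_of_lt v.isLt]
    exact Fin.val_inj
  rw [ringAdj, zmod_natCast_eq_add_one_iff u v, zmod_natCast_eq_add_one_iff v u, ne_eq, ne_eq, hinj,
    Fin.val_inj]

/-- The diagonal jumps in coordinates: `Y = X + (e₁ ± e₂)` iff `Y₀ = X₀ + 1` and `Y₁ = X₁ ± 1`.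
[folklore] -/
private theorem exists_eq_add_torusDiagJump_iff {L : ℕ} (X Y : TorusSite 2 L) :
    (∃ s : Fin 2, Y = X + torusDiagJump L s) ↔
      Y 0 = X 0 + 1 ∧ (Y 1 = X 1 + 1 ∨ X 1 = Y 1 + 1) := by
  constructor
  · rintro ⟨s, rfl⟩
    refine ⟨by simp [torusDiagJump], ?_⟩
    fin_cases s
    · exact Or.inl (by simp [torusDiagJump])
    · exact Or.inr (by simp [torusDiagJump])
  · rintro ⟨h0, h1 | h1⟩
    · refine ⟨0, funext fun i => ?_⟩
      fin_cases i
      · simpa [torusDiagJump] using h0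
      · simpa [torusDiagJump] using h1
    · refine ⟨1, funext fun i => ?_⟩
      fin_cases i
      · simpa [torusDiagJump] using h0
      · show Y 1 = X 1 + torusDiagJump L 1 1
        rw [h1]
        simp [torusDiagJump]

/-- Non-degeneracy: a diagonal step between DISTINCT points of `(ℤ/Lℤ)²` moves both coordinates.
[folklore] -/
private theorem ne_and_ne_of_diagStep {L : ℕ} {X Y : TorusSite 2 L} (hXY : X ≠ Y)
    (h0 : Y 0 = X 0 + 1) (h1 : Y 1 = X 1 + 1 ∨ X 1 = Y 1 + 1) : X 0 ≠ Y 0 ∧ X 1 ≠ Y 1 := by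
  -- if `1 = 0` in `ZMod L` the step is trivial in both coordinates, contradicting `X ≠ Y`
  have degen : (1 : ZMod L) = 0 → False := by
    intro h10
    apply hXY
    funext i
    fin_cases i
    · show X 0 = Y 0
      rw [h0, h10, add_zero]
    · show X 1 = Y 1
      rcases h1 with h | h
      · rw [h, h10, add_zero]
      · rw [h, h10, add_zero]
  constructor
  · intro heq
    rw [heq] at h0
    exact degen (by simpa using h0.symm)
  · intro heq
    rcases h1 with h | h
    · rw [heq] at h; exact degen (by simpa using h.symm)
    · rw [heq] at h; exact degen (by simpa using h.symm)

/-- `squareToRect` carries the DIAGONAL adjacency of `(ℤ/Lℤ)²` (`fermionTorusDiagGraph L`, through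
`ZMod L`) onto that of the rectangular torus `L × L` (`fermionRectTorusDiagGraph L L`, through
representatives). [folklore] -/
private theorem fermionRectTorusDiagGraph_adj_squareToRect {L : ℕ} (x y : FermionTorus 2 L) :
    (fermionRectTorusDiagGraph L L).Adj (squareToRect L x) (squareToRect L y) ↔
      (fermionTorusDiagGraph L).Adj x y := by
  rw [fermionRectTorusDiagGraph_adj_iff, ofLex_squareToRect_fst, ofLex_squareToRect_snd,
    ofLex_squareToRect_fst, ofLex_squareToRect_snd, ringAdj_iff_zmod, ringAdj_iff_zmod]
  change ((FermionTorus.toTorusSite x 0 ≠ FermionTorus.toTorusSite y 0 ∧ _) ∧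
      (FermionTorus.toTorusSite x 1 ≠ FermionTorus.toTorusSite y 1 ∧ _)) ↔
    (torusDiagGraph L).Adj (FermionTorus.toTorusSite x) (FermionTorus.toTorusSite y)
  rw [torusDiagGraph, SimpleGraph.fromRel_adj, exists_eq_add_torusDiagJump_iff,
    exists_eq_add_torusDiagJump_iff]
  set X := FermionTorus.toTorusSite x
  set Y := FermionTorus.toTorusSite y
  constructor
  · rintro ⟨⟨hne0, h0 | h0⟩, ⟨-, h1⟩⟩
    · exact ⟨fun h => hne0 (congrFun h 0), Or.inl ⟨h0, h1⟩⟩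
    · exact ⟨fun h => hne0 (congrFun h 0), Or.inr ⟨h0, h1.symm⟩⟩
  · rintro ⟨hXY, ⟨h0, h1⟩ | ⟨h0, h1⟩⟩
    · obtain ⟨hne0, hne1⟩ := ne_and_ne_of_diagStep hXY h0 h1
      exact ⟨⟨hne0, Or.inl h0⟩, ⟨hne1, h1⟩⟩
    · obtain ⟨hne0, hne1⟩ := ne_and_ne_of_diagStep hXY.symm h0 h1
      exact ⟨⟨hne0.symm, Or.inr h0⟩, ⟨hne1.symm, h1.symm⟩⟩

/-- **`E_{(ℤ/Lℤ)²}(N) = E_{L×L}(N)` for the `t–t'` model**, every sector `N` and all `t, t', U`: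
the (order preserving) site bijection `x ↦ (x 0, x 1)` carries nearest- and next-nearest-neighbour
bonds of `(ℤ/Lℤ)²` onto those of the rectangular torus `L × L`, and site relabellings act unitarily
on Fock space (Essler et al. (2005) §2.2.1 eqs. (2.32)–(2.39)); the `t' = 0` case is the tree's
`groundEnergyAt_fermionTorusGraph_two`. [cite: EsslerEtAl2005, §2.2.1 eqs. (2.32)–(2.39)] -/
theorem groundEnergy_hubbardTorusTT'_eq_rect (L : ℕ) (t t' U : ℝ) (N : ℕ) :
    groundEnergy (hubbardTorusTT' L t t' U) N = groundEnergy (hubbardRectTorusTT' L L t t' U) N := by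
  unfold hubbardTorusTT' hubbardRectTorusTT'
  exact (groundEnergy_hamiltonian_add_eq_of_iso _ _ _ _ (squareToRect L)
    fermionRectTorusGraph_adj_squareToRect fermionRectTorusDiagGraph_adj_squareToRect t U t' 0 N).symm

/-! ### The staggering sign of a rectangular torus with even sides -/

/-- On a ring of even length `n`, ring-neighbours (representatives `u, v < n`) have coordinate
sum of odd parity (`v = u ± 1`, or the wrap-around bond `{n - 1, 0}`). [folklore] -/
private theorem odd_add_of_ringAdj {n u v : ℕ} (hn : Even n) (hu : u < n) (hv : v < n)
    (h : ringAdj n u v) : Odd (u + v) := by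
  obtain ⟨k, hk⟩ := hn
  rcases h with ⟨-, h1 | h1⟩
  · by_cases hlt : u + 1 < n
    · rw [Nat.mod_eq_of_lt hlt] at h1
      exact ⟨u, by omega⟩
    · have heq : u + 1 = n := by omega
      rw [heq, Nat.mod_self] at h1
      exact ⟨k - 1, by omega⟩
  · by_cases hlt : v + 1 < n
    · rw [Nat.mod_eq_of_lt hlt] at h1
      exact ⟨v, by omega⟩
    · have heq : v + 1 = n := by omega
      rw [heq, Nat.mod_self] at h1
      exact ⟨k - 1, by omega⟩

/-- `(-1)^u = -(-1)^v` in `ℤˣ` when `u + v` is odd. [folklore] -/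
private theorem neg_one_pow_eq_neg_of_odd_add {u v : ℕ} (h : Odd (u + v)) :
    ((-1 : ℤˣ) ^ u) = -(-1) ^ v := by
  -- `^` on `ℤˣ` elaborates to `Int.instUnitsPow` (definitionally the monoid power): `uzpow_*`
  have h1 : ((-1 : ℤˣ) ^ u * (-1) ^ v) = -1 := by
    rw [← uzpow_add]; exact h.neg_one_pow
  have h2 : ((-1 : ℤˣ) ^ v * (-1) ^ v) = 1 := by
    rw [← uzpow_add]; exact Even.neg_one_pow ⟨v, rfl⟩
  calc ((-1 : ℤˣ) ^ u) = (-1) ^ u * ((-1) ^ v * (-1) ^ v) := by rw [h2, mul_one]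
    _ = ((-1) ^ u * (-1) ^ v) * (-1) ^ v := (mul_assoc _ _ _).symm
    _ = -(-1) ^ v := by rw [h1, neg_one_mul]

/-- The bipartite (staggering) sign `ε_{(x,y)} = (-1)^{x+y} ∈ ℤˣ` of the rectangular torus, on
representatives `x < a`, `y < b` (the analogue of `torusStagger`). Lieb, PRL 62 (1989) 1201
(`ε(x) = ±1` on the two sublattices). [folklore] -/
def rectStagger (a b : ℕ) (p : Fin a ×ₗ Fin b) : ℤˣ :=
  (-1) ^ (((ofLex p).1 : ℕ) + ((ofLex p).2 : ℕ))

/-- **The rectangular torus with even sides is bipartite**: nearest neighbours carry opposite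
staggering signs. Lieb, PRL 62 (1989) 1201, Theorem 2 (bipartite lattices; the periodic square
lattice with even periods as the example). [cite: LiebPRL1989, Theorem 2 (bipartite lattice)] -/
theorem rectStagger_eq_neg_of_adj {a b : ℕ} (ha : Even a) (hb : Even b) {p q : Fin a ×ₗ Fin b}
    (h : (fermionRectTorusGraph a b).Adj p q) : rectStagger a b p = -rectStagger a b q := by
  rcases h with ⟨h2, h1⟩ | ⟨h1, h2⟩
  · have hodd := odd_add_of_ringAdj ha (ofLex p).1.isLt (ofLex q).1.isLt h1
    unfold rectStagger
    rw [uzpow_add, uzpow_add, h2, neg_one_pow_eq_neg_of_odd_add hodd, neg_mul]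
  · have hodd := odd_add_of_ringAdj hb (ofLex p).2.isLt (ofLex q).2.isLt h2
    unfold rectStagger
    rw [uzpow_add, uzpow_add, h1, neg_one_pow_eq_neg_of_odd_add hodd, mul_neg]

/-- On a rectangular torus with even sides, DIAGONAL neighbours carry equal staggering signs (both
coordinates change parity: next-nearest neighbours lie in the same sublattice; Essler et al. (2005)
§2.2.4, the sublattices after eq. (2.60); Lin–Hirsch, PRB 35 (1987) 3359).
[cite: EsslerEtAl2005, §2.2.4, bipartite sublattices after eq. (2.60)] -/
theorem rectStagger_eq_of_diagAdj {a b : ℕ} (ha : Even a) (hb : Even b) {p q : Fin a ×ₗ Fin b}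
    (h : (fermionRectTorusDiagGraph a b).Adj p q) : rectStagger a b p = rectStagger a b q := by
  obtain ⟨h1, h2⟩ := h
  have ho1 := odd_add_of_ringAdj ha (ofLex p).1.isLt (ofLex q).1.isLt h1
  have ho2 := odd_add_of_ringAdj hb (ofLex p).2.isLt (ofLex q).2.isLt h2
  unfold rectStagger
  rw [uzpow_add, uzpow_add, neg_one_pow_eq_neg_of_odd_add ho1, neg_one_pow_eq_neg_of_odd_add ho2,
    neg_mul_neg]

/-! ### Particle–hole symmetry of the `t–t'` model on rectangular tori with even sides -/

section Rect

variable {a b : ℕ}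

/-- **Particle–hole conjugation of the rectangular `t–t'` Hamiltonian.** On `ℤ/aℤ × ℤ/bℤ` with
`a, b` even and `P` the particle–hole unitary with phases `(-1)^{x+y}`:
`P H(t, t', U) Pᴴ = H(t, -t', U) - U N + U ab` (nearest-neighbour hopping invariant, diagonal
hopping changes sign). Essler et al. (2005) §2.2.4 eqs. (2.59)–(2.61) and the remark after (2.60);
Lin–Hirsch, PRB 35 (1987) 3359; Lieb, PRL 62 (1989) 1201. [cite: EsslerEtAl2005, §2.2.4 eqs. (2.59)–(2.61)] -/
theorem particleHole_hubbardRectTorusTT' (ha : Even a) (hb : Even b) (t t' U : ℝ) :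
    particleHole (fun i : Orb (Fin a ×ₗ Fin b) => ((rectStagger a b (ofLex i).1 : ℤ) : ℂ)) *
        hubbardRectTorusTT' a b t t' U *
        (particleHole (fun i : Orb (Fin a ×ₗ Fin b) => ((rectStagger a b (ofLex i).1 : ℤ) : ℂ)))ᴴ =
      hubbardRectTorusTT' a b t (-t') U - (U : ℂ) • totalNumber +
        ((U * (a * b) : ℝ) : ℂ) •
          (1 : Matrix (Finset (Orb (Fin a ×ₗ Fin b))) (Finset (Orb (Fin a ×ₗ Fin b))) ℂ) := by
  have hNN := hamiltonian_particleHole_bipartite_holds (fermionRectTorusGraph a b) t U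
    (rectStagger a b) (fun x y hxy => rectStagger_eq_neg_of_adj ha hb hxy)
  have hNNN := hamiltonian_particleHole_sameSign (fermionRectTorusDiagGraph a b) t' 0
    (rectStagger a b) (fun x y hxy => rectStagger_eq_of_diagAdj ha hb hxy)
  have hcard : Fintype.card (Fin a ×ₗ Fin b) = a * b := card_rectSites a b
  have key := congrArg₂ (· + ·) hNN hNNN
  simp only [zero_mul, Complex.ofReal_zero, zero_smul, sub_zero, add_zero] at key
  rw [← Matrix.add_mul, ← Matrix.mul_add, ← hubbardRectTorusTT', add_right_comm,
    sub_add_eq_add_sub, ← hubbardRectTorusTT', hcard] at key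
  push_cast at key ⊢
  convert key

/-- **Particle–hole symmetry of the rectangular `t–t'` sector energies**: for `a, b` even,
`N ≤ 2ab` and all `t, t', U`, `E_{t,t',U}(2ab - N) = E_{t,-t',U}(N) - U N + U ab`, where
`E_{t,t',U}(N) = groundEnergy (hubbardRectTorusTT' a b t t' U) N`: hole doping at `t'` is electron
doping at `-t'` up to the explicit constant. Lieb–Wu, Physica A 321 (2003) 1, §1 eq. (3); Essler et
al. (2005) §2.2.4; Lin–Hirsch, PRB 35 (1987) 3359. [cite: LiebWuPhysicaA2003, §1 eq. (3)] -/
theorem groundEnergy_hubbardRectTorusTT'_particleHole (ha : Even a) (hb : Even b) (t t' U : ℝ)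
    {N : ℕ} (hN : N ≤ 2 * (a * b)) :
    groundEnergy (hubbardRectTorusTT' a b t t' U) (2 * (a * b) - N) =
      groundEnergy (hubbardRectTorusTT' a b t (-t') U) N - U * N + U * (a * b) := by
  have hcard : Fintype.card (Fin a ×ₗ Fin b) = a * b := card_rectSites a b
  have hn : ∀ i : Orb (Fin a ×ₗ Fin b), ‖((rectStagger a b (ofLex i).1 : ℤ) : ℂ)‖ = 1 :=
    fun i => norm_intCast_units _
  have hNN := hamiltonian_particleHole_bipartite_holds (fermionRectTorusGraph a b) t U
    (rectStagger a b) (fun x y hxy => rectStagger_eq_neg_of_adj ha hb hxy)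
  have hNNN := hamiltonian_particleHole_sameSign (fermionRectTorusDiagGraph a b) t' 0
    (rectStagger a b) (fun x y hxy => rectStagger_eq_of_diagAdj ha hb hxy)
  have key := congrArg₂ (· + ·) hNN hNNN
  simp only [zero_mul, Complex.ofReal_zero, zero_smul, sub_zero, add_zero] at key
  rw [← Matrix.add_mul, ← Matrix.mul_add, ← hubbardRectTorusTT', add_right_comm,
    sub_add_eq_add_sub, ← hubbardRectTorusTT'] at key
  have h := groundEnergy_particleHole_transfer _ hn key (N := N) (by rw [hcard]; exact hN)
  rw [hcard] at h
  rw [h]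
  push_cast
  ring

/-- The same symmetry read from the `N`-particle side: for `a, b` even and `N ≤ 2ab`,
`E_{t,t',U}(N) = E_{t,-t',U}(2ab - N) - (ab - N) U`. Lieb–Wu, Physica A 321 (2003) 1, §1 eq. (3);
Lin–Hirsch, PRB 35 (1987) 3359. [cite: LiebWuPhysicaA2003, §1 eq. (3)] -/
theorem groundEnergy_hubbardRectTorusTT'_particleHole' (ha : Even a) (hb : Even b) (t t' U : ℝ)
    {N : ℕ} (hN : N ≤ 2 * (a * b)) :
    groundEnergy (hubbardRectTorusTT' a b t t' U) N =
      groundEnergy (hubbardRectTorusTT' a b t (-t') U) (2 * (a * b) - N) -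
        ((a * b : ℝ) - N) * U := by
  have h := groundEnergy_hubbardRectTorusTT'_particleHole ha hb t t' U (N := 2 * (a * b) - N)
    (Nat.sub_le _ _)
  rw [show 2 * (a * b) - (2 * (a * b) - N) = N by omega] at h
  rw [h, Nat.cast_sub hN]
  push_cast
  ring

/-- **Particle–hole symmetry of the rectangular Hubbard torus** (`t' = 0`): for `a, b` even and
`N ≤ 2ab`, `E_N = E_{2ab-N} - (ab - N) U` for `groundEnergyAt (fermionRectTorusGraph a b) t U`.
Lieb–Wu, Physica A 321 (2003) 1, §1 eq. (3); Lieb, PRL 62 (1989) 1201.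
[cite: LiebWuPhysicaA2003, §1 eq. (3)] -/
theorem groundEnergyAt_fermionRectTorus_particleHole (ha : Even a) (hb : Even b) (t U : ℝ) {N : ℕ}
    (hN : N ≤ 2 * (a * b)) :
    groundEnergyAt (fermionRectTorusGraph a b) t U N =
      groundEnergyAt (fermionRectTorusGraph a b) t U (2 * (a * b) - N) - ((a * b : ℝ) - N) * U := by
  have hcard : Fintype.card (Fin a ×ₗ Fin b) = a * b := card_rectSites a b
  have h := groundEnergyAt_particleHole (fermionRectTorusGraph a b) (rectStagger a b)
    (fun x y hxy => rectStagger_eq_neg_of_adj ha hb hxy) t U (N := N) (by rw [hcard]; exact hN)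
  rw [hcard] at h
  rw [h]
  push_cast
  ring

end Rect

end Literature.MathematicalPhysics.QuantumLattice

end
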